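import Mathlib
import Summits.ValiantsHypothesis.ValiantsHypothesis.Theorems.SymPencilSymmetrizePermPairsPermifySubgroupIndex
import Summits.ValiantsHypothesis.ValiantsHypothesis.Theorems.SymPencilSymmetrizePermPairsInducedBlockPencilPerm
import HarnessLib

/-!
# ValiantsHypothesis / SymPencil — crux `SymmetrizePermPairs` (stmt-ValiantsHypothesis-17793),
# stub `stub_induce`: the EXACT WIRING `stub_induce ⇐ (C3)` over the landed permify_subgroup branch
# ([A4] `permify_of_le_permPairSubst`) and the induced blocks ((I1′) `inducedBlock_permPairs_perm`)

`stub_induce_of_C3 : (C3) → ⟨stub_induce, verbatim⟩`, where (C3) is the equivariant-GKKP target of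
the tenure's (C3) memo §1 (`NOTE-p7g11-17793-C3-equivariantGKKP-sizing.md`), taken as a hypothesis
VERBATIM: «a covariant family of `R ≥ 1` affine pencils `B_i` of size `m′` with `det B_i = per_n`
(covariance = the output clause of `inducedBlock_permPairs_perm`) yields a SYMMETRIC `Γ_n`-equivariant
affine determinantal representation of `per_n` of size `≤ (R m′ + 2)^e`».  The registered signature of
`stub_induce` (`Cruxes/SdcThesis/Lines/birth_SymmetrizePermPairs.lean`, with the line file's
`abbrev permPairSubst n` spelled out) then follows by: [A4] (permutation-conjugation lifts over `Γ'`
at cost `2^{(log₂(mR+m)+d)^d}`) → (I1′) (the `R = [Γ_n : Γ']` translates, a covariant family) →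
(C3) → budget bookkeeping `(R m′ + 2)^e ≤ 2^{(log₂(mR+m)+d+2e+2)^{d+2e+2}}` (`budget_comp`; for
`m = 0` one has `n = 0` and `R = 1`).  Finiteness of `Γ_n` (needed for `[Γ_n : Γ'] ≥ 1`) is proved
from the pair homomorphism (`permPairSubst_eq_range`, `finite_permPairSubst`).

Honest framing: WIRING ONLY — (C3) is OPEN (pieces [Q2]/[Q3]/(C3c,d) in flight elsewhere); when it
lands as a theorem of the exact shape below, `stub_induce` is `stub_induce_of_C3 ‹(C3)›`; the crux
then still rests on `stub_stabIndex`; `stub_induce`, the crux `SymmetrizePermPairs` and `VP ≠ VNP`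
remain OPEN and nothing here is progress on `VP ≠ VNP`.  No new definitions, no named facts
(`--supports stmt-ValiantsHypothesis-17793 --as helper`).
-/

noncomputable section

-- `Summit.ValiantsHypothesis.ValiantsHypothesis.…` is the tree's mandated single-conjunct layout
-- (Sub = Summit), so the duplicated namespace component is intended.
set_option linter.dupNamespace false

namespace Summit.ValiantsHypothesis.ValiantsHypothesis.Theorems.SymPencilEquivariantSdcNotQP

open Literature.Computability.AlgebraicComplexity MvPolynomial Matrix

/-! ### `Γ_n` is the range of the pair homomorphism, hence finite -/

/-- `Γ_n = permPairSubst n` (the closure of the permutation matrices of `Equiv.prodCongr π ρ`) is the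
range of a homomorphism from `𝔖_n × 𝔖_n` — namely `θ (π, ρ) = P_{(π × ρ)⁻¹}`
(`Matrix.permMatrixHom`, unit-valued). [folklore] -/
theorem permPairSubst_eq_range (n : ℕ) :
    ∃ θ : Equiv.Perm (Fin n) × Equiv.Perm (Fin n) →* GL (Fin n × Fin n) ℂ,
      Subgroup.closure {γ : GL (Fin n × Fin n) ℂ | ∃ π ρ : Equiv.Perm (Fin n),
        (γ : Matrix (Fin n × Fin n) (Fin n × Fin n) ℂ) =
          Equiv.Perm.permMatrix ℂ (Equiv.prodCongr π ρ)} = θ.range := by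
  classical
  let θ₀ : Equiv.Perm (Fin n) × Equiv.Perm (Fin n) →* Equiv.Perm (Fin n × Fin n) :=
    { toFun := fun πρ => Equiv.prodCongr πρ.1 πρ.2
      map_one' := by ext ⟨i, j⟩ <;> rfl
      map_mul' := fun a b => by ext ⟨i, j⟩ <;> rfl }
  let θ : Equiv.Perm (Fin n) × Equiv.Perm (Fin n) →* GL (Fin n × Fin n) ℂ :=
    (Matrix.permMatrixHom (n := Fin n × Fin n) (R := ℂ)).toHomUnits.comp θ₀
  have hθinv : ∀ πρ : Equiv.Perm (Fin n) × Equiv.Perm (Fin n),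
      (((θ πρ)⁻¹ : GL (Fin n × Fin n) ℂ) : Matrix (Fin n × Fin n) (Fin n × Fin n) ℂ) =
        Equiv.Perm.permMatrix ℂ (Equiv.prodCongr πρ.1 πρ.2) := fun πρ => rfl
  have hθ : ∀ πρ : Equiv.Perm (Fin n) × Equiv.Perm (Fin n),
      ((θ πρ : GL (Fin n × Fin n) ℂ) : Matrix (Fin n × Fin n) (Fin n × Fin n) ℂ) =
        Equiv.Perm.permMatrix ℂ (Equiv.prodCongr πρ.1 πρ.2)⁻¹ := fun πρ => rfl
  refine ⟨θ, le_antisymm ?_ ?_⟩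
  · rw [Subgroup.closure_le]
    rintro γ ⟨π, ρ, hγ⟩
    refine ⟨(π, ρ)⁻¹, ?_⟩
    rw [map_inv]
    exact Units.ext (by rw [hθinv]; exact hγ.symm)
  · rintro γ ⟨πρ, rfl⟩
    refine Subgroup.subset_closure ⟨πρ.1⁻¹, πρ.2⁻¹, ?_⟩
    have he : (Equiv.prodCongr πρ.1 πρ.2)⁻¹ = Equiv.prodCongr πρ.1⁻¹ πρ.2⁻¹ :=
      Equiv.ext fun _ => rfl
    rw [hθ, he]

/-- `Γ_n` is finite. [folklore] -/
theorem finite_permPairSubst (n : ℕ) :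
    Finite ↥(Subgroup.closure {γ : GL (Fin n × Fin n) ℂ | ∃ π ρ : Equiv.Perm (Fin n),
        (γ : Matrix (Fin n × Fin n) (Fin n × Fin n) ℂ) =
          Equiv.Perm.permMatrix ℂ (Equiv.prodCongr π ρ)}) := by
  obtain ⟨θ, hθ⟩ := permPairSubst_eq_range n
  rw [hθ]
  exact Finite.of_surjective θ.rangeRestrict θ.rangeRestrict_surjective

/-! ### Budget bookkeeping `(R m′ + 2)^e` versus `2^{(log₂(mR+m)+D)^D}` -/

/-- If `R ≤ m R + m + 1` (i.e. `m ≥ 1`, or `R = 1`) and `m′ ≤ 2^{(log₂(mR+m)+d)^d}` then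
`(R m′ + 2)^e ≤ 2^{(log₂(mR+m) + (d+2e+2))^{d+2e+2}}`. [folklore] -/
theorem budget_comp (R m m' d e : ℕ) (hRle : R ≤ m * R + m + 1)
    (hm' : m' ≤ 2 ^ ((Nat.log 2 (m * R + m) + d) ^ d)) :
    (R * m' + 2) ^ e ≤ 2 ^ ((Nat.log 2 (m * R + m) + (d + 2 * e + 2)) ^ (d + 2 * e + 2)) := by
  set L := Nat.log 2 (m * R + m) with hL
  set Q := (L + d) ^ d with hQ
  have hN : m * R + m + 1 ≤ 2 ^ (L + 1) := Nat.lt_pow_succ_log_self one_lt_two _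
  have hR : R ≤ 2 ^ (L + 1) := hRle.trans hN
  have hpos : 2 ≤ 2 ^ (L + 1) * 2 ^ Q := by
    calc 2 = 2 ^ 1 * 1 := by norm_num
      _ ≤ 2 ^ (L + 1) * 2 ^ Q :=
        Nat.mul_le_mul (Nat.pow_le_pow_right (by norm_num) (by omega)) (Nat.one_le_two_pow)
  have h1 : R * m' + 2 ≤ 2 ^ (L + Q + 2) := by
    calc R * m' + 2 ≤ 2 ^ (L + 1) * 2 ^ Q + 2 := Nat.add_le_add_right (Nat.mul_le_mul hR hm') _
      _ ≤ 2 ^ (L + 1) * 2 ^ Q + 2 ^ (L + 1) * 2 ^ Q := Nat.add_le_add_left hpos _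
      _ = 2 ^ (L + Q + 2) := by rw [← pow_add]; ring
  have h2 : (R * m' + 2) ^ e ≤ 2 ^ ((L + Q + 2) * e) := by
    rw [pow_mul]; exact Nat.pow_le_pow_left h1 e
  refine h2.trans (Nat.pow_le_pow_right (by norm_num) ?_)
  -- `(L + Q + 2) e ≤ (L + (d + 2e + 2))^{d + 2e + 2}`
  rcases Nat.eq_zero_or_pos e with he0 | he
  · simp [he0]
  set x := L + (d + 2 * e + 2) with hx
  have hx2 : 2 ≤ x := by omega
  have hQx : Q ≤ x ^ d := Nat.pow_le_pow_left (by omega) d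
  have hxd : x ^ d ≤ x ^ (d + 1) := Nat.pow_le_pow_right (by omega) (by omega)
  have hx1 : x ≤ x ^ (d + 1) := by
    calc x = x ^ 1 := (pow_one x).symm
      _ ≤ x ^ (d + 1) := Nat.pow_le_pow_right (by omega) (by omega)
  have hsum : L + Q + 2 ≤ x ^ (d + 1) + x ^ (d + 1) := by
    have : L + 2 ≤ x := by omega
    omega
  calc (L + Q + 2) * e ≤ (x ^ (d + 1) + x ^ (d + 1)) * x := Nat.mul_le_mul hsum (by omega)
    _ = 2 * x ^ (d + 2) := by ring
    _ ≤ x * x ^ (d + 2) := Nat.mul_le_mul_right _ hx2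
    _ = x ^ (d + 3) := by ring
    _ ≤ x ^ (d + 2 * e + 2) := Nat.pow_le_pow_right (by omega) (by omega)

/-! ### The wiring -/

/-- **`stub_induce ⇐ (C3)`** (exact wiring).  Hypothesis `hC3` = the (C3) target of the tenure's
memo §1 VERBATIM (with `permPairSubst n` spelled out): a covariant family of `R ≥ 1` affine pencils of
size `m′`, each with determinant `per_n`, yields a symmetric `Γ_n`-equivariant affine determinantal
representation of `per_n` of size `≤ (R m′ + 2)^e`.  Conclusion = the registered signature of
`stub_induce` verbatim.  Proof: `permify_of_le_permPairSubst` ([A4]) → `inducedBlock_permPairs_perm`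
((I1′)) → `hC3` → `budget_comp`.  Conditional on (C3); `stub_induce` / the crux / `VP ≠ VNP` OPEN.
[folklore] -/
theorem stub_induce_of_C3
    (hC3 : ∃ e : ℕ, ∀ (n R m' : ℕ)
      (B : Fin R → Matrix (Fin m') (Fin m') (MvPolynomial (Fin n × Fin n) ℂ)),
      (∀ i, IsAffineDetRepr (perPoly (Fin n) ℂ) (B i)) →
      (∀ π ρ : Equiv.Perm (Fin n), ∃ (τ : Equiv.Perm (Fin R)) (P : Fin R → Equiv.Perm (Fin m')),
        ∀ i, (B i).map (MvPolynomial.rename fun ij : Fin n × Fin n => (π ij.1, ρ ij.2)) =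
          ((P i).permMatrix ℂ).map MvPolynomial.C * B (τ i) *
            (((P i).permMatrix ℂ)ᵀ).map MvPolynomial.C) →
      1 ≤ R →
      ∃ m'' ≤ (R * m' + 2) ^ e, ∃ A'' : Matrix (Fin m'') (Fin m'') (MvPolynomial (Fin n × Fin n) ℂ),
        A''.IsSymm ∧ IsEquivariantDetRepr (Subgroup.closure {γ : GL (Fin n × Fin n) ℂ |
          ∃ π ρ : Equiv.Perm (Fin n), (γ : Matrix (Fin n × Fin n) (Fin n × Fin n) ℂ) =
            Equiv.Perm.permMatrix ℂ (Equiv.prodCongr π ρ)}) (perPoly (Fin n) ℂ) A'') :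
    ∃ d : ℕ, ∀ (n m : ℕ) (A : Matrix (Fin m) (Fin m) (MvPolynomial (Fin n × Fin n) ℂ))
      (Γ' : Subgroup (GL (Fin n × Fin n) ℂ)),
      Γ' ≤ Subgroup.closure {γ : GL (Fin n × Fin n) ℂ | ∃ π ρ : Equiv.Perm (Fin n),
        (γ : Matrix (Fin n × Fin n) (Fin n × Fin n) ℂ) = Equiv.Perm.permMatrix ℂ (Equiv.prodCongr π ρ)} →
      A.IsSymm →
      IsEquivariantDetRepr Γ' (perPoly (Fin n) ℂ) A →
      ∃ m' ≤ 2 ^ ((Nat.log 2 (m * Γ'.relIndex (Subgroup.closure {γ : GL (Fin n × Fin n) ℂ |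
          ∃ π ρ : Equiv.Perm (Fin n), (γ : Matrix (Fin n × Fin n) (Fin n × Fin n) ℂ) =
            Equiv.Perm.permMatrix ℂ (Equiv.prodCongr π ρ)}) + m) + d) ^ d),
        ∃ A' : Matrix (Fin m') (Fin m') (MvPolynomial (Fin n × Fin n) ℂ),
          A'.IsSymm ∧ IsEquivariantDetRepr (Subgroup.closure {γ : GL (Fin n × Fin n) ℂ |
            ∃ π ρ : Equiv.Perm (Fin n), (γ : Matrix (Fin n × Fin n) (Fin n × Fin n) ℂ) =
              Equiv.Perm.permMatrix ℂ (Equiv.prodCongr π ρ)}) (perPoly (Fin n) ℂ) A' := by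
  classical
  obtain ⟨d, hd⟩ := permify_of_le_permPairSubst
  obtain ⟨e, he⟩ := hC3
  refine ⟨d + 2 * e + 2, fun n m A Γ' hle _hsymm hA => ?_⟩
  -- `n = deg per_n ≤ m`
  have hnm : n ≤ m := by
    have h := totalDegree_le_of_hasDetRepr_holds
      (show HasDetRepr (perPoly (Fin n) ℂ) m from ⟨A, hA.1⟩)
    rwa [totalDegree_perPoly_holds, Fintype.card_fin] at h
  -- [A4]: permutation-conjugation lifts over `Γ'`
  obtain ⟨m', hm', A', hA', -, hperm⟩ := hd n m Γ' hle A hA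
  -- finiteness of `Γ_n` and the relative index `R ≥ 1`
  haveI hfin := finite_permPairSubst n
  haveI : (Γ'.subgroupOf (Subgroup.closure {γ : GL (Fin n × Fin n) ℂ | ∃ π ρ : Equiv.Perm (Fin n),
      (γ : Matrix (Fin n × Fin n) (Fin n × Fin n) ℂ) =
        Equiv.Perm.permMatrix ℂ (Equiv.prodCongr π ρ)})).FiniteIndex :=
    ⟨Subgroup.index_ne_zero_of_finite⟩
  have hR1 : 1 ≤ Γ'.relIndex (Subgroup.closure {γ : GL (Fin n × Fin n) ℂ | ∃ π ρ : Equiv.Perm (Fin n),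
      (γ : Matrix (Fin n × Fin n) (Fin n × Fin n) ℂ) =
        Equiv.Perm.permMatrix ℂ (Equiv.prodCongr π ρ)}) :=
    Nat.pos_of_ne_zero Subgroup.FiniteIndex.index_ne_zero
  -- (I1′): the covariant family of translates
  obtain ⟨B, hBaff, hBcov, -, -⟩ :=
    SymPencilSymmetrizePermPairs.InducedBlock.inducedBlock_permPairs_perm n m' _ Γ' rfl A' hA' hperm
  -- (C3)
  obtain ⟨m'', hm'', A'', hA''symm, hA''⟩ := he n _ m' B hBaff hBcov hR1
  refine ⟨m'', hm''.trans (budget_comp _ m m' d e ?_ hm'), A'', hA''symm, hA''⟩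
  -- `R ≤ m R + m + 1`: for `m ≥ 1` trivially; for `m = 0`, `n = 0` and `R = 1`
  rcases Nat.eq_zero_or_pos m with hm0 | hm
  · have hn0 : n = 0 := by omega
    subst hn0
    have htop : Γ'.subgroupOf (Subgroup.closure {γ : GL (Fin 0 × Fin 0) ℂ |
        ∃ π ρ : Equiv.Perm (Fin 0), (γ : Matrix (Fin 0 × Fin 0) (Fin 0 × Fin 0) ℂ) =
          Equiv.Perm.permMatrix ℂ (Equiv.prodCongr π ρ)}) = ⊤ := by
      refine (Subgroup.eq_top_iff' _).mpr fun x => ?_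
      rw [Subgroup.mem_subgroupOf]
      have hx : (x : GL (Fin 0 × Fin 0) ℂ) = 1 := Subsingleton.elim _ _
      rw [hx]
      exact Γ'.one_mem
    rw [Subgroup.relIndex, htop, Subgroup.index_top]
    omega
  · calc Γ'.relIndex _ = 1 * Γ'.relIndex _ := (one_mul _).symm
      _ ≤ m * Γ'.relIndex _ := Nat.mul_le_mul_right _ hm
      _ ≤ m * Γ'.relIndex _ + m + 1 := by omega

end Summit.ValiantsHypothesis.ValiantsHypothesis.Theorems.SymPencilEquivariantSdcNotQP

end
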